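import Literature.MathematicalPhysics.QuantumFieldTheory.ConformalBootstrap3D.PointKernelK34L505Data
import Literature.MathematicalPhysics.QuantumFieldTheory.ConformalBootstrap3D.PointKernelK34L505Segs
import Literature.MathematicalPhysics.QuantumFieldTheory.ConformalBootstrap3D.PointKernelParts

/-!
# K34L505 certificate, kernel part file P51: one-cell head segments 114, 115 in level ranges

The head cells whose kernel evaluation exceeds one `decide` are one-cell segments of `hsegsK34L505`; each is
checked by `PCert.hPartSideOK` (side conditions) and `PCert.hPartOK` per level range `[n_lo, n_lo + count)`
against an integer claim, the claims summing to `≥ 0` (`PointKernel.partsOK`); soundness is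
`PCert.hParts_sound` (`PointKernelParts`).  The part files are mutually independent (each imports only
the data file); the ranges of one cell may span several of them, and the per-cell conclusions
`hparts_i` / `hcell_i` of those cells are assembled in `PointKernelK34L505.lean`.
Estimated kernel time 230 s.
-/

set_option maxRecDepth 100000
set_option maxHeartbeats 0

namespace Literature.MathematicalPhysics.QuantumFieldTheory.ConformalBootstrap3D.PointKernelK34L505

open Literature.MathematicalPhysics.QuantumFieldTheory.ConformalBootstrap3D.PointKernel

/-- levels `[30, 43)` of segment 114: partial lower sum `≥` claim. [folklore] -/
theorem part_114_1 : certK34L505.hPartOK (PCert.segAt hsegsK34L505 114) JHK34L505 30 13 (12571568116449570941321995141125225922) = true := by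
  decide +kernel

/-- levels `[43, 52)` of segment 114: partial lower sum `≥` claim. [folklore] -/
theorem part_114_2 : certK34L505.hPartOK (PCert.segAt hsegsK34L505 114) JHK34L505 43 9 (2530004411261926884644050752716596252) = true := by
  decide +kernel

/-- levels `[52, 57)` of segment 114: partial lower sum `≥` claim. [folklore] -/
theorem part_114_3 : certK34L505.hPartOK (PCert.segAt hsegsK34L505 114) JHK34L505 52 5 (423473674610200857562609922997596725) = true := by
  decide +kernel

/-- one-cell segment 115 (row 6, cell `[899/128, 1799/256]`, chord, `n_F = 48`,
3 level ranges): side conditions. [folklore] -/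
theorem pside_115 : certK34L505.hPartSideOK (PCert.segAt hsegsK34L505 115) JHK34L505 = true := by
  decide +kernel

/-- its level ranges `(n_lo, count, claim)`. [folklore] -/
def partsK34L505_115 : List (ℕ × ℕ × ℤ) := [(0, 31, -12774174432117735794119815001774170299), (31, 13, 11415780581213300070608199581529267084), (44, 5, 1358393850904435723511615420244903216)]

/-- the ranges tile `[0, n_F]` and the claims sum to `≥ 0`. [folklore] -/
theorem pcov_115 : PointKernel.partsOK 48 partsK34L505_115 = true := by
  decide +kernel

/-- levels `[0, 31)` of segment 115: partial lower sum `≥` claim. [folklore] -/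
theorem part_115_0 : certK34L505.hPartOK (PCert.segAt hsegsK34L505 115) JHK34L505 0 31 (-12774174432117735794119815001774170299) = true := by
  decide +kernel

end Literature.MathematicalPhysics.QuantumFieldTheory.ConformalBootstrap3D.PointKernelK34L505
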